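import Summits.QuantumFields.BalabanUV.T4Continuum.Spine.NE1p.DressedSmallFieldMixedLetterLocal

/-!
# T⁴ programme, spine estimate NE1′ (node O3b/H2) — THE MIXED CUBE LETTER ON THE SUBSTRATE's (2.14) INDEX `Jc ⊕ 𝒴`: with BOTH blocks LIVE,
# the cube block and the polymer block DECOUPLE on `lamJ (Jc ⊕ 𝒴)` at the printed radii `radii κ₁ r` (cubes on `|σ(Δ)| = e^{κ₁}`, polymers on their
# (2.18) circles) — `∫ wJ·(F∘σ|_{cubes})·exp(Σ_Y τ(Y)·𝐕(Y)) dlamJ = Δ_univ F · Π_Y (e^{𝐕(Y)} − 1)` with its (2.15)-shape majorant; N0k's END re-fired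
# with the term's parameter space of the substrate's SHAPE `(Jc ⊕ 𝒴) → ℝ × ℝ` and W39.2's activity `actF` UNCHANGED (representation independence)

Cell `pub-balaban`, sub-cell `t4`, row NE1′ formalisation crew (`t4/formal/NE1p/LEAVES.md` row W46 ∕ DAG N29zzn; own-initiative witness under typer
R-T61 (ii) in the W29∕W34∕W39∕W43 line of unit `b2b-balaban-t4-ne1p-formalise-leaf-08`, gen 10; INTENT journal l.18837, BOOKED R-T125 l.19575, X-read
X159).  ADDITIVE — imports W43 `DressedSmallFieldMixedLetterLocal` ONLY
(⇒ W39.2∕W39.1∕W34∕W29, the NE5 substrate `Support/B13TermContours` — §2 `lamJ`∕`wJ`∕`wBJ`∕`sigmaJ`, §3 `radii`∕`radii_inl`∕`radii_inr`, BY NAME —,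
N0k `DressedSmallFieldShape`, W23's catalogue, W25); 3 toy DATA `def`s (`νI`, `preI`, `linI`) + 2 instances + theorems + 1 `example`; 0 `def … : Prop`,
0 cite, 0 sorry; nothing of N0k∕W23∕W29∕W34∕W39∕W43∕the substrate restated.

WHY THIS FILE.  (2.14) p. 15 integrates ONE expression over ALL contour variables at once — «Π_{Δ⊂Z∖Z′₀} ∫ds(Δ)∮dσ(Δ) … Π_{Y∈𝐃} ∫dt(Y)∮dτ(Y)
… [table-free factor of the s(Δ), σ(Δ)] · exp[Σ_{Y∈𝐃} τ(Y)𝐕(Y,B)]» (TYPE).  The substrate types that index as `Jc ⊕ 𝒴` with radii `radii κ₁ r`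
(§3); W29 read the POLYMER block alone (`mayerProduct_rep` on `lamJ J`), W39∕W43 the CUBE block alone (`mixedLetter_rep(_local)` on `Fin n`), and
the one NE1′ module on the Sum index (W40 `DressedSmallFieldSlotWitness`, `Jcf := PEmpty`) keeps the cube block EMPTY.  Here both blocks are LIVE
in one integral:
* §1 **`integral_pi_sum`** — Fubini across the index (Mathlib `measurePreserving_sumPiEquivProdPi_symm`, first use in this cell); `lamJ_sum`;
  `mixedLetter_rep_local_univ` (W43 at `S = univ` in the substrate's currency); **`fullLetter_rep`**: for `0 < κ₁ < log R`, (2.18) radii `r Y > 1`,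
  `F` analytic on the open polydisc of radius `R` and evaluation functionals `e Y`,
  `∫ wJ (radii κ₁ r) p·F(σ(p)|_{cubes})·exp(Σ_Y τ_Y(p)·e_Y(Q)) ∂lamJ(Fin n ⊕ J) = Δ_univ F · Π_Y (e^{e_Y(Q)} − 1)` (+ the entire case);
  **`fullLetter_majorant_le`**: `≤ e^{−(κ₁−1)·n}·B·(Π_Y r_Y∕(r_Y−1)²)·e^{Σ_Y r_Y‖e_Y‖‖Q‖}` — (2.15)'s «exp(−(κ₁−1)·#cubes)·Π_Y(polymer letter)» shape.
* §2 N0k's END with the term measure `νI Z = ⨂_{Fin 2 ⊕ Unit} Sum.elim (μS (cubes₂ Z)) lam₁` (cube letters of `Z` + ONE Mayer letter on the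
  circle of radius `2`), prefactor `preI`, functional `linI` (W29's `linJ` at radius `2`), and **W39.2's activity `actF F` BY NAME**: `hrep_I` ((B1) a
  THEOREM on the index space), `hL3_I` (same bound as W39.2's `hL3_F`), **`muPart_fires_I`** (N0k ONCE BY NAME, ∀ κ₁ ≥ 6) and `muPart_fires_I_Fj`
  on W39.2's decided non-product `Fj` — the SAME `E_μ(univ) − E_0(univ)` as W39.2 bounds, now from a representation on the substrate's index SHAPE;
  W39.2's `locE_live_Fj`∕`Fj_not_product` apply verbatim (the closing `example`).

HONEST FRAMING.  [folklore] product-measure bookkeeping (Fubini across `Sum`, along `Fin.cons` through W39∕W43, the substrate's one-variable Cauchy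
letter, compactness) on the substrate's CONTOUR OBJECTS over W23's decided catalogue; the identification of `Fin n ⊕ J` with (2.14)'s «Δ ⊂ Z∖Z′₀,
Y ∈ 𝐃», of `F` with print's s(Δ)-dependent operator products and of `e Y` with «𝐕(Y,B)» is a TYPE READING; the polydisc bound `hB` is the toy's
HYPOTHESIS of (1.18)∕(1.21) TYPE — nothing of Bałaban's (2.14) factors constructed or bounded; `κ₁ ≥ 1 ∕ ≥ 6`, radius `2`, `1∕12`, `3∕16` are OUR
thresholds on OUR majorants and W23's numerals — no numeral of [Balaban1988RGII]; (B1)∕(B3)∕(B5) for (2.14) NOT discharged ((B3) = GAPS G-ne9p2-5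
UNPRINTED untouched); 0 binders instantiated on Bałaban's densities ∕ operators ∕ (2.14) data ∕ `d_k` ∕ minimisers ∕ backgrounds; discharges no wall
item; wall v1.7 (T4-DAG v43) does NOT move; R-t4r2-Q2 NOT met thereby; NE1′ ⇐ the named binders — NOT proved, NOT printed; spine PROVED 0∕9; count 9
unchanged.  Rung (B)+1 on ONE finite four-torus — NOT infinite volume, NOT a mass gap, NOT OS on ℝ⁴, NOT Clay.  ABSOLUTE RULE honoured: the
quotation is a LOCUS of the audited manuscript [Balaban1988RGII] (CMP 116 (1988) 1–22, p. 15), TYPE∕CONTEXT only; nothing internally minted is cited;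
[folklore] tags on kernel lemmas only.  HONEST DEPENDENCY: continuum YM on T⁴ ⇐ BetaPertH ∧ nine spine estimates (0/9 proved); BetaPertH ⇐ (D1) ∧
(D4) ∧ CAP+tail; G-an2-4 gates asym, D1 and NE2/3/4.
-/

noncomputable section

namespace Summit.QuantumFields.BalabanUV.T4Continuum.NE1p.DressedSmallFieldMixedLetterIndex

open MeasureTheory Metric Set Complex Finset
open scoped BigOperators Function
open Summit.QuantumFields.BalabanUV.T4Continuum.B13TermContours
open Literature.MathematicalPhysics.QuantumFieldTheory.Balaban1983to89.B13Resummation (locE)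
open Literature.Probability.LatticeModels (polyInc)
open Summit.QuantumFields.BalabanUV.T4Continuum.NE1p.DressedSmallFieldShape (muPart_locE_le_of_linearDressing)
open Summit.QuantumFields.BalabanUV.T4Continuum.NE1p.DressedSmallFieldPencilWitness
  (Pol cubes₂ d₂ hloc₂ hd₂ h126₂ hvol₂ h227₂ hsmall₂ envelope₂_eq)
open Summit.QuantumFields.BalabanUV.T4Continuum.NE1p.DressedSmallFieldContourWitness
  (linC linJ linJ_apply norm_linJ_le majorant_C_le hint_J mayerProduct_rep ev ev_apply norm_ev_le oR V₀M OM norm_V₀M_le norm_OM_le)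
open Summit.QuantumFields.BalabanUV.T4Continuum.NE1p.DressedSmallFieldCubeLetterWitness
  (one_lt_rexp decouplingFactor_pow_le cK cK_pos card_cubes₂)
open Summit.QuantumFields.BalabanUV.T4Continuum.NE1p.DressedSmallFieldMixedLetter
open Summit.QuantumFields.BalabanUV.T4Continuum.NE1p.DressedSmallFieldMixedLetterWitness
  (rK actF hB_σS hL3_F Fj differentiable_Fj hB_Fj Fj_not_product locE_live_Fj)
open Summit.QuantumFields.BalabanUV.T4Continuum.NE1p.DressedSmallFieldMixedLetterLocal (mixedLetter_rep_local continuous_σS)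
open DressedSmallFieldPencilWitness.Pol

variable {n : ℕ} {J : Type*} [Fintype J] {Pot : Type*} [NormedAddCommGroup Pot] [NormedSpace ℂ Pot]

/-! ## §1 FUBINI ACROSS THE (2.14) INDEX: a cube block `Jc = Fin n` and a polymer block `𝒴 = J` -/

/-- [folklore] Every coordinate measure of a `Sum.elim` family of finite measures is finite. -/
instance isFiniteMeasure_elim (μc : Fin n → Measure (ℝ × ℝ)) (μp : J → Measure (ℝ × ℝ)) [∀ i, IsFiniteMeasure (μc i)]
    [∀ Y, IsFiniteMeasure (μp Y)] (i : Fin n ⊕ J) : IsFiniteMeasure (Sum.elim μc μp i) := by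
  cases i <;> dsimp only [Sum.elim_inl, Sum.elim_inr] <;> infer_instance

/-- **FUBINI ACROSS THE (2.14) INDEX** [folklore] (Mathlib `measurePreserving_sumPiEquivProdPi_symm` + `integral_prod_mul`): an integrand that is a
product of a function of the cube coordinates and a function of the polymer coordinates integrates to the product of the block integrals. -/
theorem integral_pi_sum {L : Type*} [RCLike L] (μc : Fin n → Measure (ℝ × ℝ)) (μp : J → Measure (ℝ × ℝ)) [∀ i, IsFiniteMeasure (μc i)]
    [∀ Y, IsFiniteMeasure (μp Y)] (f : (Fin n → ℝ × ℝ) → L) (g : (J → ℝ × ℝ) → L) :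
    ∫ p, f (fun Δ => p (Sum.inl Δ)) * g (fun Y => p (Sum.inr Y)) ∂(Measure.pi (Sum.elim μc μp)) =
      (∫ a, f a ∂(Measure.pi μc)) * ∫ b, g b ∂(Measure.pi μp) := by
  have hmp := measurePreserving_sumPiEquivProdPi_symm (Sum.elim μc μp)
  rw [← hmp.integral_comp']
  have he : ∀ x : (Fin n → ℝ × ℝ) × (J → ℝ × ℝ),
      (fun p : Fin n ⊕ J → ℝ × ℝ => f (fun Δ => p (Sum.inl Δ)) * g (fun Y => p (Sum.inr Y)))
        ((MeasurableEquiv.sumPiEquivProdPi fun _ : Fin n ⊕ J => ℝ × ℝ).symm x) = f x.1 * g x.2 := fun x => rfl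
  simp_rw [he]
  exact integral_prod_mul (μ := Measure.pi fun i => Sum.elim μc μp (Sum.inl i)) (ν := Measure.pi fun i => Sum.elim μc μp (Sum.inr i)) f g

/-- [folklore] The substrate's product contour measure on the (2.14) index IS such a `Sum.elim` family. -/
theorem lamJ_sum (n : ℕ) (J : Type*) [Fintype J] :
    lamJ (Fin n ⊕ J) = Measure.pi (Sum.elim (fun _ : Fin n => lam₁) (fun _ : J => lam₁)) := by
  unfold lamJ; congr 1; funext i; cases i <;> rfl

/-- **THE n-CUBE LETTER IN THE SUBSTRATE's CURRENCY, LOCAL FORM** (W43 `mixedLetter_rep_local` at `S = univ` through W39.1's `univ` faces): for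
`F` analytic on the open polydisc of radius `R > ρ > 1`, `∫ wJ ρ p·F(sigmaJ ρ p) ∂lamJ (Fin n) = Δ_univ F`. -/
theorem mixedLetter_rep_local_univ {ρ R : ℝ} (hρ : 1 < ρ) (hR : ρ < R) (F : (Fin n → ℂ) → ℂ)
    (hF : DifferentiableOn ℂ F (Set.univ.pi fun _ => ball (0 : ℂ) R)) :
    ∫ p, wJ (fun _ => ρ) p * F (sigmaJ (fun _ => ρ) p) ∂(lamJ (Fin n)) = mixedDiff n Finset.univ F := by
  rw [← pi_μS_univ, ← wS_univ, ← σS_univ]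
  exact mixedLetter_rep_local n _ (fun _ => R) _ F (fun _ => hρ) (fun _ => hR) hF

/-- **THE FULL (2.14) LETTER ON THE SUBSTRATE's INDEX `Jc ⊕ 𝒴` DECOUPLES** (kernel; the substrate's §3 `radii κ₁ r` ∕ `radii_inl` ∕ `radii_inr` BY NAME —
their first NE1′ consumer; §1 Fubini; W43's local cube dictionary; W29 `mayerProduct_rep` on the polymer block): for `0 < κ₁`, `e^{κ₁} < R`, every
(2.18) radius `r Y > 1`, a table-free factor `F` of ALL the cube variables analytic on the open polydisc of radius `R` (print's p. 6 TYPE), and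
evaluation functionals `e Y` on any table space,
`∫ wJ (radii κ₁ r) p · F(σ(p)|_{cubes}) · exp(Σ_Y τ_Y(p)·e_Y(Q)) ∂lamJ(Fin n ⊕ J) = Δ_univ F · Π_Y (e^{e_Y(Q)} − 1)`
— (2.14)'s «Π_{Δ} ∫ds(Δ)∮dσ(Δ) … Π_{Y∈𝐃} ∫dt(Y)∮dτ(Y) … [table-free factor] exp[Σ_{Y∈𝐃} τ(Y)𝐕(Y)]» (p. 15, TYPE) in kernel on the substrate's objects. -/
theorem fullLetter_rep {κ₁ R : ℝ} (hκ : 0 < κ₁) (hR : Real.exp κ₁ < R) {r : J → ℝ} (hr : ∀ Y, 1 < r Y) (F : (Fin n → ℂ) → ℂ)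
    (hF : DifferentiableOn ℂ F (Set.univ.pi fun _ => ball (0 : ℂ) R)) (e : J → Pot →L[ℂ] ℂ) (Q : Pot) :
    ∫ p, wJ (radii κ₁ r) p * (F (fun Δ => sigmaJ (radii κ₁ r) p (Sum.inl Δ)) *
        cexp (∑ Y, sigmaJ (radii κ₁ r) p (Sum.inr Y) * e Y Q)) ∂(lamJ (Fin n ⊕ J)) =
      mixedDiff n Finset.univ F * ∏ Y, (cexp (e Y Q) - 1) := by
  set f : (Fin n → ℝ × ℝ) → ℂ := fun a => wJ (fun _ => Real.exp κ₁) a * F (fun Δ => circ (Real.exp κ₁) (a Δ).2) with hf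
  set g : (J → ℝ × ℝ) → ℂ := fun b => wJ r b * cexp (linJ r e b Q) with hg
  have hsplit : ∀ p : Fin n ⊕ J → ℝ × ℝ,
      wJ (radii κ₁ r) p * (F (fun Δ => sigmaJ (radii κ₁ r) p (Sum.inl Δ)) * cexp (∑ Y, sigmaJ (radii κ₁ r) p (Sum.inr Y) * e Y Q)) =
        f (fun Δ => p (Sum.inl Δ)) * g (fun Y => p (Sum.inr Y)) := fun p => by
    rw [hf, hg]; dsimp only
    rw [linJ_apply]
    simp only [wJ, Fintype.prod_sum_type, radii_inl, radii_inr, sigmaJ]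
    ring
  simp_rw [hsplit]
  rw [lamJ_sum, integral_pi_sum]
  change (∫ a, wJ (fun _ => Real.exp κ₁) a * F (sigmaJ (fun _ => Real.exp κ₁) a) ∂(lamJ (Fin n))) *
      ∫ b, wJ r b * cexp (linJ r e b Q) ∂(lamJ J) = _
  rw [mixedLetter_rep_local_univ (one_lt_rexp hκ) hR F hF, mayerProduct_rep hr e Q]

/-- The ENTIRE case (W39.1's class) of the full letter. [folklore] -/
theorem fullLetter_rep_entire {κ₁ : ℝ} (hκ : 0 < κ₁) {r : J → ℝ} (hr : ∀ Y, 1 < r Y) (F : (Fin n → ℂ) → ℂ) (hF : Differentiable ℂ F)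
    (e : J → Pot →L[ℂ] ℂ) (Q : Pot) :
    ∫ p, wJ (radii κ₁ r) p * (F (fun Δ => sigmaJ (radii κ₁ r) p (Sum.inl Δ)) *
        cexp (∑ Y, sigmaJ (radii κ₁ r) p (Sum.inr Y) * e Y Q)) ∂(lamJ (Fin n ⊕ J)) =
      mixedDiff n Finset.univ F * ∏ Y, (cexp (e Y Q) - 1) :=
  fullLetter_rep hκ (by linarith : Real.exp κ₁ < Real.exp κ₁ + 1) hr F hF.differentiableOn e Q

/-- **THE (2.15) MAJORANT OF THE FULL LETTER** (kernel; §1 Fubini on the norms, W39.1 `mixedLetter_decay_le` on the cube block, W29's letter majorant on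
the polymer block): for `κ₁ ≥ 1`, `F` bounded by `B` on the cube contours, `∫ ‖…‖ ≤ e^{−(κ₁−1)·n}·B · (Π_Y r_Y∕(r_Y−1)²)·e^{Σ_Y r_Y‖e_Y‖·‖Q‖}` —
«exp(−(κ₁ − 1)·#cubes) · Π_Y (letter at the (2.18) radius) · e^{(radius)·(size of the entry)}», the shape of (2.15)'s first two factors (TYPE). -/
theorem fullLetter_majorant_le {κ₁ : ℝ} (hκ : 1 ≤ κ₁) {r : J → ℝ} (hr : ∀ Y, 1 < r Y) {F : (Fin n → ℂ) → ℂ} {B : ℝ}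
    (hB : ∀ a : Fin n → ℝ × ℝ, ‖F (sigmaJ (fun _ => Real.exp κ₁) a)‖ ≤ B) (e : J → Pot →L[ℂ] ℂ) (Q : Pot) :
    ∫ p, ‖wJ (radii κ₁ r) p * (F (fun Δ => sigmaJ (radii κ₁ r) p (Sum.inl Δ)) *
        cexp (∑ Y, sigmaJ (radii κ₁ r) p (Sum.inr Y) * e Y Q))‖ ∂(lamJ (Fin n ⊕ J)) ≤
      Real.exp (-((κ₁ - 1) * n)) * B * ((∏ Y, r Y / (r Y - 1) ^ 2) * Real.exp (∑ Y, r Y * ‖e Y‖ * ‖Q‖)) := by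
  have hB0 : 0 ≤ B := (norm_nonneg _).trans (hB fun _ => (0, 0))
  have hr0 : ∀ Y, 0 ≤ r Y := fun Y => zero_le_one.trans (hr Y).le
  set C : ℝ := ∑ Y, r Y * ‖e Y‖ * ‖Q‖ with hC
  -- split the norm across the index
  set f : (Fin n → ℝ × ℝ) → ℝ := fun a => ‖wJ (fun _ => Real.exp κ₁) a * F (fun Δ => circ (Real.exp κ₁) (a Δ).2)‖ with hf
  set g : (J → ℝ × ℝ) → ℝ := fun b => ‖wJ r b * cexp (linJ r e b Q)‖ with hg
  have hsplit : ∀ p : Fin n ⊕ J → ℝ × ℝ,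
      ‖wJ (radii κ₁ r) p * (F (fun Δ => sigmaJ (radii κ₁ r) p (Sum.inl Δ)) * cexp (∑ Y, sigmaJ (radii κ₁ r) p (Sum.inr Y) * e Y Q))‖ =
        f (fun Δ => p (Sum.inl Δ)) * g (fun Y => p (Sum.inr Y)) := fun p => by
    rw [hf, hg]; dsimp only
    rw [← norm_mul, linJ_apply]
    simp only [wJ, Fintype.prod_sum_type, radii_inl, radii_inr, sigmaJ]
    ring_nf
  simp_rw [hsplit]
  rw [lamJ_sum, integral_pi_sum (L := ℝ)]
  change (∫ a, ‖wJ (fun _ => Real.exp κ₁) a * F (sigmaJ (fun _ => Real.exp κ₁) a)‖ ∂(lamJ (Fin n))) *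
      ∫ b, ‖wJ r b * cexp (linJ r e b Q)‖ ∂(lamJ J) ≤ _
  -- cube block: W39.1's decay at `S = univ`
  have hcube : ∫ a, ‖wJ (fun _ => Real.exp κ₁) a * F (sigmaJ (fun _ => Real.exp κ₁) a)‖ ∂(lamJ (Fin n)) ≤
      Real.exp (-((κ₁ - 1) * n)) * B := by
    have h := mixedLetter_decay_le (n := n) hκ Finset.univ (F := F) (B := B) (by rw [σS_univ]; exact hB)
    rw [wS_univ, σS_univ, pi_μS_univ, Finset.card_univ, Fintype.card_fin] at h
    exact h
  -- polymer block: the exponential is bounded by `e^{C}` on the contours, then W29's weight majorant per letter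
  have hexp : ∀ b : J → ℝ × ℝ, ‖cexp (linJ r e b Q)‖ ≤ Real.exp C := fun b => by
    refine (Complex.norm_exp_le_exp_norm _).trans (Real.exp_le_exp.2 ?_)
    refine (ContinuousLinearMap.le_opNorm _ _).trans ?_
    rw [hC, ← Finset.sum_mul]
    exact mul_le_mul_of_nonneg_right (norm_linJ_le hr0 e b) (norm_nonneg _)
  have hpoly : ∫ b, ‖wJ r b * cexp (linJ r e b Q)‖ ∂(lamJ J) ≤ (∏ Y, r Y / (r Y - 1) ^ 2) * Real.exp C := by
    calc ∫ b, ‖wJ r b * cexp (linJ r e b Q)‖ ∂(lamJ J) ≤ ∫ b, ‖wJ r b‖ * Real.exp C ∂(lamJ J) :=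
          integral_mono_of_nonneg (Filter.Eventually.of_forall fun _ => norm_nonneg _) (hint_J hr C)
            (Filter.Eventually.of_forall fun b => by
              dsimp only
              rw [norm_mul]; exact mul_le_mul_of_nonneg_left (hexp b) (norm_nonneg _))
      _ = (∏ Y, ∫ x, ‖w₁ (r Y) x‖ ∂lam₁) * Real.exp C := by
          rw [integral_mul_const]
          congr 1
          simp_rw [wJ, norm_prod]
          exact integral_fintype_prod_eq_prod (𝕜 := ℝ) (fun Y x => ‖w₁ (r Y) x‖)
      _ ≤ (∏ Y, r Y / (r Y - 1) ^ 2) * Real.exp C :=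
          mul_le_mul_of_nonneg_right (Finset.prod_le_prod (fun _ _ => integral_nonneg fun _ => norm_nonneg _)
            fun Y _ => by simpa using majorant_C_le (hr Y) 0) (Real.exp_pos _).le
  exact mul_le_mul hcube hpoly (integral_nonneg fun _ => norm_nonneg _) (mul_nonneg (Real.exp_pos _).le hB0)

/-! ## §2 N0k's END WITH THE TERM SPACE OF THE SUBSTRATE's SHAPE `(Jc ⊕ 𝒴) → ℝ × ℝ` — the SAME activity as W39.2 (`actF`, BY NAME) -/

variable {F : Pol → (Fin 2 → ℂ) → ℂ} {κ₁ : ℝ}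

/-- THE TERM MEASURE on the (2.14) index of polymer `Z`: cube coordinates `Fin 2` (active cubes OF `Z`, Dirac filler else — W39.1's `μS`), ONE polymer
coordinate `Unit` (the Mayer letter of `Z` itself) — `⨂_{Fin 2 ⊕ Unit} Sum.elim (μS (cubes₂ Z)) lam₁`. -/
def νI (Z : Pol) : Measure ((Fin 2 ⊕ Unit) → ℝ × ℝ) := Measure.pi (Sum.elim (μS (cubes₂ Z)) (fun _ : Unit => lam₁))

/-- [folklore] It is finite. -/
instance isFiniteMeasure_νI (Z : Pol) : IsFiniteMeasure (νI Z) := by unfold νI; infer_instance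

/-- THE PREFACTOR on the index space: W39.2's cube block on the `inl` coordinates times W29's product weight at radius `2` on the `inr` coordinate. -/
def preI (F : Pol → (Fin 2 → ℂ) → ℂ) (κ₁ : ℝ) (Z : Pol) (p : (Fin 2 ⊕ Unit) → ℝ × ℝ) : ℂ :=
  (cK : ℂ) * (wS (rK κ₁) (cubes₂ Z) (fun Δ => p (Sum.inl Δ)) * F Z (σS (rK κ₁) (cubes₂ Z) fun Δ => p (Sum.inl Δ))) *
    wJ (fun _ : Unit => (2 : ℝ)) (fun u => p (Sum.inr u))

/-- THE FUNCTIONAL on the index space: W29's product contour functional `Σ_{u : Unit} τ_u • ev Z` at radius `2` on the `inr` coordinate. -/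
def linI (Z : Pol) (p : (Fin 2 ⊕ Unit) → ℝ × ℝ) : (Pol → ℂ) →L[ℂ] ℂ := linJ (fun _ : Unit => (2 : ℝ)) (fun _ => ev Z) fun u => p (Sum.inr u)

/-- Socket `hl`: `‖linI Z p‖ ≤ 2` (W29 `norm_linJ_le`, `norm_ev_le`). [folklore] -/
theorem hl_I (Z : Pol) (p : (Fin 2 ⊕ Unit) → ℝ × ℝ) : ‖linI Z p‖ ≤ 2 := by
  refine (norm_linJ_le (fun _ => zero_le_two) _ _).trans ?_
  rw [Fintype.sum_unique]
  linarith [mul_le_mul_of_nonneg_left (norm_ev_le Z) zero_le_two]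

/-- Socket `hlinw`. [folklore] -/
theorem hlinw_I (Z : Pol) (Q : Pol → ℂ) : AEStronglyMeasurable (fun p => linI Z p Q) (νI Z) := by
  have h : Measurable fun p : (Fin 2 ⊕ Unit) → ℝ × ℝ => ∑ u : Unit, sigmaJ (fun _ : Unit => (2 : ℝ)) (fun u => p (Sum.inr u)) u * ev Z Q :=
    Finset.measurable_sum _ fun u _ =>
      ((measurable_circ 2).comp (measurable_snd.comp (measurable_pi_apply (Sum.inr u)))).mul_const _
  exact h.aestronglyMeasurable.congr (Filter.Eventually.of_forall fun p => by simp only [linI, linJ_apply])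

/-- Socket `hpre` (continuity of the joint factor on the contour range, as in W43). [folklore] -/
theorem hpre_I (hF : ∀ Z, Differentiable ℂ (F Z)) (Z : Pol) : AEStronglyMeasurable (preI F κ₁ Z) (νI Z) := by
  have hinl : Measurable fun p : (Fin 2 ⊕ Unit) → ℝ × ℝ => fun Δ : Fin 2 => p (Sum.inl Δ) :=
    measurable_pi_lambda _ fun Δ => measurable_pi_apply (Sum.inl Δ)
  have hinr : Measurable fun p : (Fin 2 ⊕ Unit) → ℝ × ℝ => fun u : Unit => p (Sum.inr u) :=
    measurable_pi_lambda _ fun u => measurable_pi_apply (Sum.inr u)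
  exact ((measurable_const.mul (((measurable_wS _ _).comp hinl).mul
    ((hF Z).continuous.measurable.comp ((measurable_σS _ _).comp hinl)))).mul ((measurable_wJ _).comp hinr)).aestronglyMeasurable

/-- **(B1) `hrep` ON THE INDEX SPACE IS A THEOREM — for W39.2's activity `actF` UNCHANGED** (kernel; §1 Fubini × W39.1 `mixedLetter_rep` on the cube block
× W29 `mayerProduct_rep` on the one-letter polymer block): the same closed-form activity is represented on the substrate's `(Jc ⊕ 𝒴) → ℝ × ℝ` SHAPE. -/
theorem hrep_I (hκ : 0 < κ₁) (hF : ∀ Z, Differentiable ℂ (F Z)) (s : ℂ) (Z : Pol) :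
    actF F s Z = ∑ j ∈ ({Z} : Finset Pol), ∫ p, preI F κ₁ j p * cexp (linI j p (V₀M + s • OM)) ∂(νI j) := by
  rw [Finset.sum_singleton]
  set f : (Fin 2 → ℝ × ℝ) → ℂ := fun a => (cK : ℂ) * (wS (rK κ₁) (cubes₂ Z) a * F Z (σS (rK κ₁) (cubes₂ Z) a)) with hf
  set g : (Unit → ℝ × ℝ) → ℂ := fun b =>
    wJ (fun _ : Unit => (2 : ℝ)) b * cexp (linJ (fun _ : Unit => (2 : ℝ)) (fun _ => ev Z) b (V₀M + s • OM)) with hg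
  have h1 : ∀ p : (Fin 2 ⊕ Unit) → ℝ × ℝ, preI F κ₁ Z p * cexp (linI Z p (V₀M + s • OM)) =
      f (fun Δ => p (Sum.inl Δ)) * g (fun u => p (Sum.inr u)) := fun p => by
    rw [hf, hg]; simp only [preI, linI]; ring
  simp_rw [h1]
  rw [νI, integral_pi_sum, hf, hg]
  dsimp only
  rw [integral_const_mul, mixedLetter_rep 2 (rK κ₁) (cubes₂ Z) (F Z) (fun _ => one_lt_rexp hκ) (hF Z)]
  change actF F s Z = (cK : ℂ) * mixedDiff 2 (cubes₂ Z) (F Z) *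
      ∫ b, wJ (fun _ : Unit => (2 : ℝ)) b * cexp (linJ (fun _ : Unit => (2 : ℝ)) (fun _ => ev Z) b (V₀M + s • OM)) ∂(lamJ Unit)
  rw [mayerProduct_rep (fun _ => one_lt_two), Fintype.prod_unique, ev_apply, actF]

/-- [folklore] Size of the prefactor on the index space: `‖preI‖ ≤ cK·(max (wB₁ e^{κ₁}) 1)²·wB₁ 2`. -/
theorem norm_preI_le (hκ : 0 < κ₁) (hB : ∀ Z σ, (∀ Δ, ‖σ Δ‖ ≤ Real.exp κ₁) → ‖F Z σ‖ ≤ 1) (Z : Pol)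
    (p : (Fin 2 ⊕ Unit) → ℝ × ℝ) : ‖preI F κ₁ Z p‖ ≤ cK * (max (wB₁ (Real.exp κ₁)) 1) ^ 2 * wB₁ 2 := by
  rw [preI, norm_mul, norm_mul, norm_mul, Complex.norm_real, Real.norm_of_nonneg cK_pos.le]
  have h0 : (0 : ℝ) ≤ max (wB₁ (Real.exp κ₁)) 1 := zero_le_one.trans (le_max_right _ _)
  have h1 : ‖wS (rK κ₁) (cubes₂ Z) fun Δ => p (Sum.inl Δ)‖ ≤ (max (wB₁ (Real.exp κ₁)) 1) ^ 2 :=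
    (norm_wS_le (fun _ => one_lt_rexp hκ) _ _).trans_eq (by rw [Finset.prod_const, Finset.card_univ, Fintype.card_fin])
  have h2 : ‖wJ (fun _ : Unit => (2 : ℝ)) fun u => p (Sum.inr u)‖ ≤ wB₁ 2 :=
    (norm_wJ_le (fun _ => one_lt_two) _).trans_eq (by rw [wBJ, Fintype.prod_unique])
  exact mul_le_mul (mul_le_mul_of_nonneg_left ((mul_le_mul h1 (hB_σS hB Z _ _) (norm_nonneg _) (pow_nonneg h0 2)).trans_eq
    (mul_one _)) cK_pos.le) h2 (norm_nonneg _) (mul_nonneg cK_pos.le (pow_nonneg h0 2))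

/-- Socket `hint`. [folklore] -/
theorem hint_I (hκ : 0 < κ₁) (hF : ∀ Z, Differentiable ℂ (F Z)) (hB : ∀ Z σ, (∀ Δ, ‖σ Δ‖ ≤ Real.exp κ₁) → ‖F Z σ‖ ≤ 1)
    (Z : Pol) (κ : ℝ) : Integrable (fun p => ‖preI F κ₁ Z p‖ * Real.exp κ) (νI Z) :=
  Integrable.mono' (integrable_const (cK * (max (wB₁ (Real.exp κ₁)) 1) ^ 2 * wB₁ 2 * Real.exp κ))
    ((hpre_I hF Z).norm.mul aestronglyMeasurable_const)
    (Filter.Eventually.of_forall fun p => by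
      rw [Real.norm_of_nonneg (by positivity)]
      exact mul_le_mul_of_nonneg_right (norm_preI_le hκ hB Z p) (Real.exp_pos κ).le)

/-- **(B3) `hL3` ON THE INDEX SPACE — DERIVED, SAME BOUND AS W39.2** (kernel; §1 Fubini on the norms, W39.1 `mixedLetter_decay_le` on the cube block,
W29's weight majorant on the one-letter polymer block). -/
theorem hL3_I (hκ : 1 ≤ κ₁) (hB : ∀ Z σ, (∀ Δ, ‖σ Δ‖ ≤ Real.exp κ₁) → ‖F Z σ‖ ≤ 1) :
    ∀ Z : Pol, cubes₂ Z ⊆ univ →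
      ∑ j ∈ ({Z} : Finset Pol), ∫ p, ‖preI F κ₁ j p‖ * Real.exp (2 * (1 / 8 + 1 * (1 / 8))) ∂(νI j) ≤
        1 / 12 * Real.exp (-((κ₁ - 1) * d₂ Z)) := by
  intro Z _
  rw [Finset.sum_singleton]
  have hhalf : (2 : ℝ) * (1 / 8 + 1 * (1 / 8)) = 1 / 2 := by norm_num
  set f : (Fin 2 → ℝ × ℝ) → ℝ := fun a => cK * ‖wS (rK κ₁) (cubes₂ Z) a * F Z (σS (rK κ₁) (cubes₂ Z) a)‖ with hf
  set g : (Unit → ℝ × ℝ) → ℝ := fun b => ‖wJ (fun _ : Unit => (2 : ℝ)) b‖ * Real.exp (1 / 2) with hg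
  have h1 : ∀ p : (Fin 2 ⊕ Unit) → ℝ × ℝ, ‖preI F κ₁ Z p‖ * Real.exp (2 * (1 / 8 + 1 * (1 / 8))) =
      f (fun Δ => p (Sum.inl Δ)) * g (fun u => p (Sum.inr u)) := fun p => by
    rw [hf, hg, hhalf]; simp only [preI, norm_mul, Complex.norm_real, Real.norm_of_nonneg cK_pos.le]; ring
  simp_rw [h1]
  rw [νI, integral_pi_sum (L := ℝ), hf, hg]
  dsimp only
  rw [integral_const_mul]
  have hcubes : ∫ a, ‖wS (rK κ₁) (cubes₂ Z) a * F Z (σS (rK κ₁) (cubes₂ Z) a)‖ ∂(Measure.pi (μS (cubes₂ Z))) ≤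
      Real.exp (-((κ₁ - 1) * d₂ Z)) := by
    refine (mixedLetter_decay_le hκ (cubes₂ Z) (B := 1) fun p => hB_σS hB Z _ p).trans ?_
    rw [mul_one, card_cubes₂]
    exact Real.exp_le_exp.2 (by nlinarith [hd₂ Z])
  have hpoly : ∫ b, ‖wJ (fun _ : Unit => (2 : ℝ)) b‖ * Real.exp (1 / 2) ∂(Measure.pi fun _ : Unit => lam₁) ≤ 2 * Real.exp (1 / 2) := by
    have h : ∫ b, ‖wJ (fun _ : Unit => (2 : ℝ)) b‖ * Real.exp (1 / 2) ∂(Measure.pi fun _ : Unit => lam₁) =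
        ∏ _u : Unit, ∫ x, ‖w₁ 2 x‖ * Real.exp (1 / 2) ∂lam₁ := by
      rw [← integral_fintype_prod_eq_prod (𝕜 := ℝ) (fun (_ : Unit) x => ‖w₁ 2 x‖ * Real.exp (1 / 2))]
      refine integral_congr_ae (Filter.Eventually.of_forall fun b => ?_)
      simp only [wJ, Fintype.prod_unique]
    rw [h, Fintype.prod_unique]
    have h2 := majorant_C_le one_lt_two (1 / 2); norm_num at h2; exact h2
  calc cK * (∫ a, ‖wS (rK κ₁) (cubes₂ Z) a * F Z (σS (rK κ₁) (cubes₂ Z) a)‖ ∂(Measure.pi (μS (cubes₂ Z)))) *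
        ∫ b, ‖wJ (fun _ : Unit => (2 : ℝ)) b‖ * Real.exp (1 / 2) ∂(Measure.pi fun _ : Unit => lam₁)
      ≤ cK * Real.exp (-((κ₁ - 1) * d₂ Z)) * (2 * Real.exp (1 / 2)) :=
        mul_le_mul (mul_le_mul_of_nonneg_left hcubes cK_pos.le) hpoly (integral_nonneg fun _ => by positivity)
          (mul_nonneg cK_pos.le (Real.exp_pos _).le)
    _ = 1 / 12 * Real.exp (-((κ₁ - 1) * d₂ Z)) := by
        have : Real.exp (1 / 2 : ℝ) ≠ 0 := (Real.exp_pos _).ne'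
        simp only [cK]; field_simp; ring

/-- **N0k's END FIRES WITH THE INDEX-SPACE REPRESENTATION — SAME ACTIVITY `actF`, SAME OUTPUT AS W39.2** (ONE application BY NAME): the small-field
output `E_μ(univ) − E_0(univ)` depends on the activity, not on the parameter space representing it; for every `κ₁ ≥ 6` and every jointly entire
family bounded by `1` on the closed polydisc, `‖E_μ(univ) − E_0(univ)‖ ≤ e·1·1·(3∕2)²·(1∕12)·e^{−1·1}·μ₀∕(1 − μ₀)`. -/
theorem muPart_fires_I (hκ : 6 ≤ κ₁) (hF : ∀ Z, Differentiable ℂ (F Z)) (hB : ∀ Z σ, (∀ Δ, ‖σ Δ‖ ≤ Real.exp κ₁) → ‖F Z σ‖ ≤ 1)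
    {μ₀ : ℝ} {μ : ℂ} (h0 : 0 < μ₀) (h01 : μ₀ < 1) (hμ : ‖μ‖ ≤ μ₀) :
    ‖locE (polyInc on cubes₂) cubes₂ (actF F μ) univ - locE (polyInc on cubes₂) cubes₂ (actF F 0) univ‖ ≤
      Real.exp 1 * 1 * 1 * (3 / 2) ^ 2 * (1 / 12) * Real.exp (-(1 * 1)) * (μ₀ / (1 - μ₀)) :=
  muPart_locE_le_of_linearDressing (polyInc on cubes₂) (reach := cubes₂) (d := d₂) (ν' := νI) (pre := preI F κ₁)
    (lin := linI) (l := fun _ _ => 2) (V₀ := V₀M) (O := OM) (terms := fun Z => {Z}) (act := actF F) (A := 1 / 12)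
    (R := κ₁ - 1) (r₁ := 1) (κ₀ := 1) (K₀ := 3 / 2) (c₁ := 1) (c := 1) (b := 1) (ν := 1) (dX := 1) (μ₁ := 1) (ε₁ := 1 / 8)
    (b₀ := 1 / 8) hloc₂ (fun Z => by rw [one_mul]) hd₂ (by norm_num) (by norm_num) (by norm_num) (by norm_num) (by norm_num)
    (by norm_num) (by norm_num) (by norm_num) h126₂ hvol₂ h227₂ (by linarith) hsmall₂ univ_nonempty
    (fun s _ Z => hrep_I (by linarith) hF s Z) (hpre_I hF) hlinw_I hl_I (fun Z => hint_I (by linarith) hF hB Z _)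
    norm_V₀M_le norm_OM_le (by norm_num) (hL3_I (by linarith) hB) h0 h01 hμ

/-- **… ON W39.2's DECIDED NON-PRODUCT FACTOR `Fj`, in closed numerals** (`≤ (3∕16)·μ₀∕(1 − μ₀)`); W39.2's GENUINE facts `Fj_not_product` and
`locE_live_Fj` apply VERBATIM — the μ-part bounded here is the same NON-ZERO quantity. -/
theorem muPart_fires_I_Fj (hκ : 6 ≤ κ₁) {μ₀ : ℝ} {μ : ℂ} (h0 : 0 < μ₀) (h01 : μ₀ < 1) (hμ : ‖μ‖ ≤ μ₀) :
    ‖locE (polyInc on cubes₂) cubes₂ (actF (Fj κ₁) μ) univ -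
        locE (polyInc on cubes₂) cubes₂ (actF (Fj κ₁) 0) univ‖ ≤ 3 / 16 * (μ₀ / (1 - μ₀)) := by
  rw [← envelope₂_eq]; exact muPart_fires_I hκ (differentiable_Fj κ₁) (hB_Fj κ₁) h0 h01 hμ

/-- [folklore] The index-space END bounds a quantity that MOVES (W39.2 `locE_live_Fj` BY NAME) for a factor that is NOT a product (`Fj_not_product`). -/
example (κ₁ : ℝ) {μ : ℝ} (hμ : 0 < μ) :
    locE (polyInc on cubes₂) cubes₂ (actF (Fj κ₁) μ) univ ≠ locE (polyInc on cubes₂) cubes₂ (actF (Fj κ₁) 0) univ ∧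
      ¬ ∃ g h : ℂ → ℂ, ∀ σ : Fin 2 → ℂ, Fj κ₁ p01 σ = g (σ 0) * h (σ 1) :=
  ⟨locE_live_Fj κ₁ hμ, Fj_not_product κ₁⟩

end Summit.QuantumFields.BalabanUV.T4Continuum.NE1p.DressedSmallFieldMixedLetterIndex

end
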